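import Literature.NumberTheory.EllipticCurves.Kato2004.IwasawaCohomologyNumberFieldIsogeny
import Literature.NumberTheory.EllipticCurves.Kato2004.IwasawaH1TorsionFreeProofs
import HarnessLib

set_option autoImplicit false

/-!
# Kato 2004 (Astérisque 295) Thm. 12.4 (2), the `p`-part, OVER A NUMBER FIELD: the `K`-side pinned Iwasawa cohomology
# `𝐇¹_{K,Γ}(T_pV) = lim←_n H¹(O_{K_n}[1/p], T_pV)` (`IwasawaH1DataOver`) has NO `p`-TORSION — every elliptic `V/K`, every
# prime `p`, every `ℤ_p`-extension of `K` (THEOREMS ONLY; the `K`-twin, line by line, of `IwasawaH1TorsionFreeProofs.lean`)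

Topic `NumberTheory/EllipticCurves`, sub-directory `Kato2004` (namespace = path).  THEOREMS ONLY (no definition, no named
fact, no `instance`, no `sorry`).  Cell bsd-cm, seat bsd-cm-prr-ty1 g29 (literature-prover), row (K2C-1) of crux
`EllipticUnitValueSevenOfGZK` (stmt-BirchSwinnertonDyer-19945): one of the CONSTRUCTIBLE fields of the Summits-side
`PinnedKatoGenusFrame` (`Rank1Residual/Additive/RamifiedSevenGenusKatoPinnedFrame.lean`) is `torsionFree_π`/`ιS_injective` —
«`𝐇′(S′_W) = H¹_Iw(Kℚ_∞/K, T₇W)` has no `π`-torsion, `π² = −7`» — which reduces to «the tree's pinned carrier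
`IK : IwasawaH1DataOver (W.baseChange K) 7 κ γ` has no `7`-torsion»; this file proves that statement for EVERY curve over a field
`K`, prime `p` and `ℤ_p`-extension, by transcribing the tree's `ℚ`-side proof (`Kato2004.IwasawaH1Data.eq_zero_of_prime_nsmul_eq_zero`,
seat bsd-potss-rkm) with `tateRep W p` replaced by `CM.tateRepK V p` and `layerCores` by `layerCoresOver`.  Nothing about any
curve, zeta element or BSD is asserted; no summit statement is touched.

## Contents (all proved; `V` a Weierstrass curve over a field `K`, elliptic; `κ : ZpExtension K p`, `Γ_n = κ.layerSubgroup n`)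

* `exists_cocycle_prime_nsmul_eqK`, `continuous_coboundary_and_mulK` — the cochain engines of `IwasawaH1ReductionRoots`
  over `K` (division of a `p`-divisible continuous crossed map by `p`; the coboundary crossed map of `m ∈ T_pV`).
* `exists_forall_smul_eq_of_layerSubgroup_succK` — `V[p]^{Γ_n}` stabilises (`V[p]` finite).
* `exists_forall_layerCoresOver_eq_zero_of_prime_smul_eq_zero` — for `n ≫ 0` the trace map `Cor : H¹(K_{n+1}, T_pV) →
  H¹(K_n, T_pV)` kills every `p`-torsion class (`Cor ∘ res = (Γ_n : Γ_{n+1}) = p`, `coresLe_resLe`, `index_layerSubgroup`).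
* **`IwasawaH1DataOver.eq_zero_of_prime_nsmul_eq_zero`** — `p • x = 0 → x = 0` on `IK.H`; corollaries
  `…eq_zero_of_prime_pow_nsmul_eq_zero`, `…eq_zero_of_C_prime_smul_eq_zero`, `…eq_zero_of_int_smul_eq_zero_of_dvd`
  (an integer `m` with `p`-adic valuation pattern `m ∣ ± p^k`, e.g. `m = −7` at `p = 7`: `m • x = 0 → x = 0`), and
  `…injective_of_comp_self_eq_zsmul` (an additive operator `T` on `IK.H` with `T (T x) = m • x`, `m = −p`, is injective — the
  CM operator `π = (√−p)_*` of the K2ᶜ row), and `…isogenyMap_injective_of_comp_self_eq_zsmul` (the push-forward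
  `IwasawaH1DataOver.isogenyMap φ` of a `K`-endomorphism `φ` with `φ ∘ φ = [m]`, `m ∣ ± p^k`, is INJECTIVE — file
  `IwasawaCohomologyNumberFieldIsogeny.lean`).

## References
* K. Kato, Astérisque 295 (2004), Thm. 12.4 (2) (p. 222: "`𝐇¹(T)` is a torsion free `Λ`-module"), §13.8 (pp. 228–229), 15.14
  (p. 264: the `K ⊂ ℚ(ζ_{p^∞})` frame, `H^q(T)` over `O_λ[[G′_∞]]`). [Kato2004Asterisque]
* J.-P. Serre, *Galois Cohomology* (1997), I §2.2, §2.4 Prop. 9. [SerreGaloisCohomology1997]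
* Tree: `Kato2004/IwasawaH1TorsionFreeProofs.lean` (the `ℚ`-side original: `coresLe_resLe`, `resLe_oneCocycleClass_eq_of_forall_apply`,
  `IwasawaH1Data.eq_zero_of_prime_nsmul_eq_zero`), `Kato2004/IwasawaH1ReductionRoots.lean` (engines),
  `Kato2004/IwasawaCohomologyNumberField.lean` (`IwasawaH1DataOver`, `layerCoresOver`), `ZpExtension.lean` (`index_layerSubgroup`).
-/

noncomputable section

open scoped NumberField
open Field CategoryTheory
open Literature.NumberTheory.GaloisRepresentations
open Literature.NumberTheory.EllipticCurves Literature.NumberTheory.EllipticCurves.Kato2004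
open Literature.NumberTheory.EllipticCurves.Kato2004.CM (tateRepK integralH1K)
open WeierstrassCurve (geomPoints geomTorsion)

namespace Literature.NumberTheory.EllipticCurves.Kato2004

variable {K : Type} [Field K] (V : WeierstrassCurve K) [V.IsElliptic] (p : ℕ) [Fact p.Prime]
  [ContinuousSMul ℤ_[p] (V.tateModule p)]

/-! ## §1 The cochain engines over `K` -/

omit [V.IsElliptic] in
/-- **Division by `p` on crossed maps (over `K`).**  A continuous map `c : U → T_pV` satisfying the crossed homomorphism
identity whose values reduce to `0` in `V[p]` is `p • d` for a continuous crossed homomorphism `d` (`(d g)_n = (c g)_{n+1}`).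
[cite: Kato2004Asterisque, §13.8 (p. 228)] -/
theorem exists_cocycle_prime_nsmul_eqK (U : Subgroup (absoluteGaloisGroup K))
    (c : U → V.tateModule p) (hc : Continuous c)
    (hmul : ∀ g h : U, c (g * h) = c g + (subgroupRep (tateRepK V p).toTopRep U).ρ g (c h))
    (h1 : ∀ g, TateModule.proj p 1 (c g) = 0) :
    ∃ d : contOneCocycles (subgroupRep (tateRepK V p).toTopRep U), ∀ g, p • d.1 g = c g := by
  let d₀ : U → V.tateModule p := fun g =>
    TateModule.mk (fun n => TateModule.proj p (n + 1) (c g))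
      (fun n => by rw [TateModule.pow_smul_proj_succ, h1])
      (fun n => TateModule.smul_proj_succ (n + 1) (c g))
  have hd₀ : ∀ g, p • d₀ g = c g := fun g => by
    refine TateModule.ext fun n => ?_
    rw [map_nsmul, TateModule.proj_mk, TateModule.smul_proj_succ]
  have hd₀cont : Continuous d₀ := by
    refine continuous_induced_rng.mpr (continuous_pi fun n => ?_)
    exact (TateModule.continuous_proj (n + 1)).comp hc
  have hdmul : ∀ g h : U, d₀ (g * h) = d₀ g + (subgroupRep (tateRepK V p).toTopRep U).ρ g (d₀ h) :=
    fun g h => by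
    refine TateModule.eq_of_prime_nsmul_eq ?_
    rw [hd₀, nsmul_add, hd₀, ← map_nsmul, hd₀, hmul]
  exact ⟨⟨⟨d₀, hd₀cont⟩, hdmul⟩, hd₀⟩

omit [V.IsElliptic] in
/-- The coboundary crossed map `g ↦ g m − m` of `m ∈ T_pV` is continuous and satisfies the crossed homomorphism identity.
[cite: SerreGaloisCohomology1997, I §2.2] -/
theorem continuous_coboundary_and_mulK (U : Subgroup (absoluteGaloisGroup K)) (m : V.tateModule p) :
    Continuous (fun g : U => (subgroupRep (tateRepK V p).toTopRep U).ρ g m - m) ∧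
      ∀ g h : U, (subgroupRep (tateRepK V p).toTopRep U).ρ (g * h) m - m =
        ((subgroupRep (tateRepK V p).toTopRep U).ρ g m - m) +
          (subgroupRep (tateRepK V p).toTopRep U).ρ g ((subgroupRep (tateRepK V p).toTopRep U).ρ h m - m) := by
  refine ⟨(((tateRepK V p).continuous_apply_left m).comp continuous_subtype_val).sub continuous_const,
    fun g h => ?_⟩
  have hgh : (subgroupRep (tateRepK V p).toTopRep U).ρ (g * h) m =
      (subgroupRep (tateRepK V p).toTopRep U).ρ g ((subgroupRep (tateRepK V p).toTopRep U).ρ h m) := by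
    rw [map_mul]; rfl
  rw [hgh, map_sub]
  abel

/-! ## §2 The trace map kills the `p`-torsion of `H¹(K_{n+1}, T_pV)` for `n ≫ 0` -/

variable (κ : ZpExtension K p)

omit [ContinuousSMul ℤ_[p] (V.tateModule p)] in
/-- **Stabilisation of `V[p]^{Γ_n}`** along a `ℤ_p`-extension `κ` of `K`: the fixed sets increase with `n` inside the finite
`V[p]`, hence are constant from some `n₀` on. [cite: Kato2004Asterisque, §13.8 (p. 228)] -/
theorem exists_forall_smul_eq_of_layerSubgroup_succK :
    ∃ n₀ : ℕ, ∀ n, n₀ ≤ n → ∀ P : geomTorsion V (p : ℤ),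
      (∀ g ∈ κ.layerSubgroup (n + 1), g • (P : geomPoints V) = P) →
        ∀ g ∈ κ.layerSubgroup n, g • (P : geomPoints V) = P := by
  haveI : NeZero p := ⟨(Fact.out : p.Prime).ne_zero⟩
  haveI : Finite (geomTorsion V (p : ℤ)) := finite_geomTorsion_of_neZero V p
  let F : ℕ →o Set (geomTorsion V (p : ℤ)) :=
    { toFun := fun n ↦ {P | ∀ g ∈ κ.layerSubgroup n, g • (P : geomPoints V) = P}
      monotone' := fun n m hnm P hP g hg ↦ hP g (κ.layerSubgroup_antitone hnm hg) }
  obtain ⟨n₀, hn₀⟩ := WellFoundedGT.monotone_chain_condition F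
  refine ⟨n₀, fun n hn P hP ↦ ?_⟩
  have hmem : P ∈ F (n + 1) := hP
  rw [← hn₀ (n + 1) (hn.trans (Nat.le_succ n)), hn₀ n hn] at hmem
  exact hmem

/-- **For `n ≫ 0` the trace map `Cor : H¹(K_{n+1}, T_pV) → H¹(K_n, T_pV)` kills every `p`-torsion class** (every elliptic
`V/K`, `p`, `ℤ_p`-extension `κ` of `K`): a class `y = [c]` with `p y = 0` has `p c = ∂m` with `m mod p ∈ V[p]^{Γ_{n+1}} =
V[p]^{Γ_n}` (`n ≥ n₀`), so `p⁻¹ ∂m` is a continuous cocycle `d` on `Γ_n` with `res [d] = y` and `p [d] = 0`; then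
`Cor y = Cor res [d] = (Γ_n : Γ_{n+1}) [d] = p [d] = 0`.  The levelwise content of Kato's §13.8 ("`lim← H⁰ = 0`"), over `K`.
[cite: Kato2004Asterisque, Thm. 12.4 (2) (p. 222) and §13.8 (pp. 228–229)] [cite: SerreGaloisCohomology1997, I §2.4 Prop. 9] -/
theorem exists_forall_layerCoresOver_eq_zero_of_prime_smul_eq_zero :
    ∃ n₀ : ℕ, ∀ n, n₀ ≤ n → ∀ y : H1 (tateRepK V p) (κ.layerSubgroup (n + 1)),
      (p : ℤ_[p]) • y = 0 → layerCoresOver (tateRepK V p) κ n y = 0 := by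
  have hp : p.Prime := Fact.out
  obtain ⟨n₀, hn₀⟩ := exists_forall_smul_eq_of_layerSubgroup_succK V p κ
  refine ⟨n₀, fun n hn y hy ↦ ?_⟩
  have hle : κ.layerSubgroup (n + 1) ≤ κ.layerSubgroup n := κ.layerSubgroup_antitone (Nat.le_succ n)
  -- `y = [c]`, `p • c = ∂m`
  obtain ⟨c, hc⟩ := oneCocycleClass_surjective _ y
  have hy' : oneCocycleClass _ ((p : ℤ_[p]) • c) = 0 := by rw [oneCocycleClass_smul, hc]; exact hy
  rw [oneCocycleClass_eq_zero_iff] at hy'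
  obtain ⟨m, hm⟩ := hy'
  have hm' : ∀ g : (κ.layerSubgroup (n + 1)), p • c.1 g =
      (subgroupRep (tateRepK V p).toTopRep (κ.layerSubgroup (n + 1))).ρ g m - m := fun g ↦ by
    rw [← hm g, Submodule.coe_smul, ContinuousMap.smul_apply, Nat.cast_smul_eq_nsmul]
  -- the reduction `P = m mod p` is `Γ_{n+1}`-fixed, hence `Γ_n`-fixed
  have hPm : TateModule.proj p 1 m ∈ geomTorsion V (p : ℤ) := by
    have h := V.proj_tateModule_mem_geomTorsion p 1 m
    rwa [pow_one] at h
  set P : geomTorsion V (p : ℤ) := ⟨TateModule.proj p 1 m, hPm⟩ with hPdef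
  have hPfix' : ∀ g : (κ.layerSubgroup (n + 1)), (g : absoluteGaloisGroup K) • (P : geomPoints V) = P := fun g ↦ by
    have h := congrArg (TateModule.proj p 1) (hm' g)
    rw [map_nsmul, map_sub] at h
    change p • TateModule.proj p 1 (c.1 g) =
      TateModule.proj p 1 ((g : absoluteGaloisGroup K) • m) - TateModule.proj p 1 m at h
    rw [TateModule.proj_smul_of_distribMulAction] at h
    have h0 : p • TateModule.proj p 1 (c.1 g) = 0 := by
      have := TateModule.pow_smul_proj 1 (c.1 g); rwa [pow_one] at this
    rw [h0, eq_comm, sub_eq_zero] at h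
    exact h
  have hPfix : ∀ g : (κ.layerSubgroup n), (g : absoluteGaloisGroup K) • (P : geomPoints V) = P := fun g ↦
    hn₀ n hn P (fun g hg ↦ hPfix' ⟨g, hg⟩) g g.2
  -- `d = p⁻¹ ∂m`, a continuous cocycle on `Γ_n`
  obtain ⟨hcont, hmul⟩ := continuous_coboundary_and_mulK V p (κ.layerSubgroup n) m
  obtain ⟨d, hd⟩ := exists_cocycle_prime_nsmul_eqK V p (κ.layerSubgroup n) _ hcont hmul fun g ↦ by
    rw [map_sub]
    change TateModule.proj p 1 ((g : absoluteGaloisGroup K) • m) - _ = 0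
    rw [TateModule.proj_smul_of_distribMulAction]
    change (g : absoluteGaloisGroup K) • (P : geomPoints V) - (P : geomPoints V) = 0
    rw [hPfix g, sub_self]
  -- `res [d] = [c]`
  have hdc : ∀ g : κ.layerSubgroup (n + 1), d.1 (subgroupInclusion hle g) = c.1 g := fun g ↦ by
    refine TateModule.eq_of_prime_nsmul_eq ?_
    rw [hd, hm', subgroupRep_ρ_apply, subgroupRep_ρ_apply, subgroupInclusion_apply_coe]
  have hres : resLe (tateRepK V p).toTopRep hle 1 (oneCocycleClass _ d) = oneCocycleClass _ c :=
    resLe_oneCocycleClass_eq_of_forall_apply (tateRepK V p).toTopRep hle d c hdc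
  -- `p • [d] = [∂m] = 0`
  have hpd : (p : ℤ_[p]) • oneCocycleClass _ d = 0 := by
    rw [← oneCocycleClass_smul, oneCocycleClass_eq_zero_iff]
    refine ⟨m, fun g ↦ ?_⟩
    rw [Submodule.coe_smul, ContinuousMap.smul_apply, Nat.cast_smul_eq_nsmul, hd g]
  -- `Cor [c] = Cor res [d] = (Γ_n : Γ_{n+1}) • [d] = p • [d] = 0`
  have hidx : ((κ.layerSubgroup (n + 1)).subgroupOf (κ.layerSubgroup n)).index = p := by
    have h1 := Subgroup.relIndex_mul_index hle
    rw [ZpExtension.index_layerSubgroup, ZpExtension.index_layerSubgroup, pow_succ'] at h1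
    exact Nat.eq_of_mul_eq_mul_right (pow_pos hp.pos n) h1
  haveI : CompactSpace (absoluteGaloisGroup K) := absoluteGaloisGroup_compactSpace K
  haveI : (κ.layerSubgroup (n + 1)).FiniteIndex :=
    finiteIndex_of_isOpen_of_compactSpace _ (κ.isOpen_layerSubgroup (n + 1))
  letI : Fintype (κ.layerSubgroup n ⧸ (κ.layerSubgroup (n + 1)).subgroupOf (κ.layerSubgroup n)) :=
    Fintype.ofFinite _
  rw [← hc, ← hres, layerCoresOver_eq_coresLe, coresLe_resLe, hidx]
  exact hpd

/-! ## §3 `𝐇¹_{K,Γ}(T_pV)` has no `p`-torsion -/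

variable {V p κ} {γ : absoluteGaloisGroup K}

/-- **Kato Thm. 12.4 (2), `p`-part, on the `K`-side pin: `𝐇¹_{K,Γ}(T_pV)` has no `p`-torsion.** For every elliptic `V/K`,
prime `p`, `ℤ_p`-extension `κ` of `K` and every datum `IK : IwasawaH1DataOver V p κ γ`, an element `x` with `p • x = 0` is `0`:
its components are norm-compatible `p`-torsion classes, so they vanish from `n₀` on
(`exists_forall_layerCoresOver_eq_zero_of_prime_smul_eq_zero`), hence everywhere (downwards along `Cor`), and `proj` is
jointly injective. [cite: Kato2004Asterisque, Thm. 12.4 (2) (p. 222) and §13.8 (pp. 228–229), 15.14 (p. 264)] -/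
theorem IwasawaH1DataOver.eq_zero_of_prime_nsmul_eq_zero (IK : IwasawaH1DataOver V p κ γ) (x : IK.H)
    (hx : p • x = 0) : x = 0 := by
  obtain ⟨n₀, hn₀⟩ := exists_forall_layerCoresOver_eq_zero_of_prime_smul_eq_zero V p κ
  have htors : ∀ n, (p : ℤ_[p]) • IK.proj n x = 0 := fun n ↦ by
    rw [Nat.cast_smul_eq_nsmul, ← map_nsmul, hx, map_zero]
  have hge : ∀ n, n₀ ≤ n → IK.proj n x = 0 := fun n hn ↦ by
    rw [← IK.cores_proj n x]
    exact hn₀ n hn _ (htors (n + 1))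
  have hall : ∀ m n, n₀ ≤ n + m → IK.proj n x = 0 := by
    intro m
    induction m with
    | zero => exact fun n hn ↦ hge n (by simpa using hn)
    | succ m ih =>
      intro n hn
      rw [← IK.cores_proj n x, ih (n + 1) (by omega), map_zero]
  exact IK.proj_injective x fun n ↦ hall n₀ n (Nat.le_add_left n₀ n)

/-- **No `p^k`-torsion in `𝐇¹_{K,Γ}(T_pV)`**: `p^k • x = 0 → x = 0`. [cite: Kato2004Asterisque, Thm. 12.4 (2) (p. 222)] -/
theorem IwasawaH1DataOver.eq_zero_of_prime_pow_nsmul_eq_zero (IK : IwasawaH1DataOver V p κ γ) (k : ℕ)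
    (x : IK.H) (hx : p ^ k • x = 0) : x = 0 := by
  induction k generalizing x with
  | zero => rwa [pow_zero, one_smul] at hx
  | succ k ih =>
    rw [pow_succ, mul_smul] at hx
    exact ih x (IK.eq_zero_of_prime_nsmul_eq_zero (p ^ k • x) (by rwa [smul_comm] at hx))

/-- **No `p`-torsion as a `Λ = ℤ_p⟦T⟧`-module**: `C(p) • x = 0 → x = 0` (constants act through the `ℤ_p`-structure of the
levels, `proj_C_smul`). [cite: Kato2004Asterisque, Thm. 12.4 (2) (p. 222)] -/
theorem IwasawaH1DataOver.eq_zero_of_C_prime_smul_eq_zero (IK : IwasawaH1DataOver V p κ γ) (x : IK.H)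
    (hx : (PowerSeries.C (p : ℤ_[p]) : IwasawaAlgebra p) • x = 0) : x = 0 := by
  obtain ⟨n₀, hn₀⟩ := exists_forall_layerCoresOver_eq_zero_of_prime_smul_eq_zero V p κ
  have htors : ∀ n, (p : ℤ_[p]) • IK.proj n x = 0 := fun n ↦ by
    rw [← IK.proj_C_smul (p : ℤ_[p]) n x, hx, map_zero]
  have hge : ∀ n, n₀ ≤ n → IK.proj n x = 0 := fun n hn ↦ by
    rw [← IK.cores_proj n x]
    exact hn₀ n hn _ (htors (n + 1))
  have hall : ∀ m n, n₀ ≤ n + m → IK.proj n x = 0 := by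
    intro m
    induction m with
    | zero => exact fun n hn ↦ hge n (by simpa using hn)
    | succ m ih =>
      intro n hn
      rw [← IK.cores_proj n x, ih (n + 1) (by omega), map_zero]
  exact IK.proj_injective x fun n ↦ hall n₀ n (Nat.le_add_left n₀ n)

/-- **No `m`-torsion for an integer `m` dividing `± p^k`** (e.g. `m = −p`): `m • x = 0 → x = 0` on `𝐇¹_{K,Γ}(T_pV)`.
[cite: Kato2004Asterisque, Thm. 12.4 (2) (p. 222)] -/
theorem IwasawaH1DataOver.eq_zero_of_int_smul_eq_zero_of_dvd (IK : IwasawaH1DataOver V p κ γ) {m : ℤ} {k : ℕ}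
    (hm : m ∣ (p : ℤ) ^ k) (x : IK.H) (hx : m • x = 0) : x = 0 := by
  obtain ⟨c, hc⟩ := hm
  refine IK.eq_zero_of_prime_pow_nsmul_eq_zero k x ?_
  have h : ((p : ℤ) ^ k) • x = 0 := by rw [hc, mul_comm, mul_smul, hx, smul_zero]
  rwa [← Nat.cast_pow, Nat.cast_smul_eq_nsmul] at h

/-- **An operator of CM type is injective on `𝐇¹_{K,Γ}(T_pV)`**: if an additive `T : IK.H → IK.H` satisfies `T (T x) = m • x`
with `m ∣ ± p^k` (for the CM endomorphism `√−p` of a curve with `p` ramified in the CM field: `m = −p`, Kato 15.14's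
`π ∈ O_λ`), then `T x = 0 → x = 0` — `𝐇′(S′) = H¹_Iw(Kℚ_∞/K, T_pW)` has no `π`-torsion.
[cite: Kato2004Asterisque, Thm. 12.4 (2) (p. 222) and 15.14 (p. 264)] -/
theorem IwasawaH1DataOver.eq_zero_of_apply_eq_zero_of_comp_self_eq_zsmul (IK : IwasawaH1DataOver V p κ γ)
    (T : IK.H →+ IK.H) {m : ℤ} {k : ℕ} (hm : m ∣ (p : ℤ) ^ k) (hT : ∀ x, T (T x) = m • x)
    (x : IK.H) (hx : T x = 0) : x = 0 :=
  IK.eq_zero_of_int_smul_eq_zero_of_dvd hm x (by rw [← hT, hx, map_zero])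

/-- **The push-forward of a CM-type endomorphism is injective on `𝐇¹_{K,Γ}(T_pV)`**: for a `K`-endomorphism `φ` of `V` with
`φ ∘ φ = [m]` on `V(K̄)`, `m ∣ ± p^k` (e.g. `φ = √−7`, `m = −7`, `p = 7`), the `Λ`-linear operator `φ_* = IwasawaH1DataOver.isogenyMap φ`
(file `IwasawaCohomologyNumberFieldIsogeny.lean`; `φ_* ∘ φ_* = m` by `isogenyMap_sq_of_comp_self_eq_zsmul`) is injective — the
uniformiser `π` of `O_𝔭 ⊂ Λ_O` acts injectively on `𝐇′(S′) = H¹_Iw(Kℚ_∞/K, T_pW)` (Kato 15.14 + Thm. 12.4 (2)).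
[cite: Kato2004Asterisque, Thm. 12.4 (2) (p. 222) and 15.14 (p. 264)] -/
theorem IwasawaH1DataOver.isogenyMap_injective_of_comp_self_eq_zsmul (IK : IwasawaH1DataOver V p κ γ)
    (hγ : κ.IsTopGenerator γ) (φ : WeierstrassCurve.Isogeny V V) {m : ℤ} {k : ℕ} (hm : m ∣ (p : ℤ) ^ k)
    (hφ : ∀ P, φ (φ P) = m • P) : Function.Injective (IK.isogenyMap φ IK hγ) := by
  refine (injective_iff_map_eq_zero _).mpr fun x hx ↦ ?_
  exact IK.eq_zero_of_apply_eq_zero_of_comp_self_eq_zsmul (IK.isogenyMap φ IK hγ).toAddMonoidHom hm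
    (fun y ↦ IK.isogenyMap_sq_of_comp_self_eq_zsmul hγ φ hφ y) x hx

end Literature.NumberTheory.EllipticCurves.Kato2004

end
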